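import Summits.CriticalPhenomena.PercolationContinuityZ3.Theorems.Transplant.KNLevelsDefs
import HarnessLib

/-!
# F6 helper — greedy extraction of pairwise far points in any graph (the `pick` of Kozma–Nitzan's Step III over levels;
# generalises `exists_subset_card_eq_separated` of `L/UniformPercolation.lean` from sup-balls of `ℤ^d` to bounded symmetric neighbourhoods)

builds on p205010 (kernel theorem, internal audit signed; external expert review pending) — nothing in this file uses p205010.
Lane `prim-bschramm`, seat `prim-bschramm-p3` (task F6 (a), split agreed with p2-g2 07:45Z); helper file
(`--supports stmt-CriticalPhenomena-4575 --as helper`).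

Kozma–Nitzan (arXiv:2401.12397 §4 p. 19) select, among `N = k·|Λ_{2(2M+4)}|` contact vertices, `k` at mutual sup-distance `> 2(2M+4)`, so
that their seeds are disjoint.  Over a general graph the same greedy argument works for any family of finite symmetric neighbourhoods
`nearF x ∋ x` of size `≤ B` (graph balls of radius twice the seed diameter, `B` from a degree bound): a finite set of `≥ K·B` vertices
contains `K` vertices pairwise outside each other's neighbourhoods.  This is the `pick` / `pick_card` / `pick_disj` input of p2's
`KNLevels.SHyp` (`Transplant/KNLevelsStepIII.lean`): `exists_subset_card_eq_apart`, and the packaged selection `apartSel` with its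
specification.

[cite: KozmaNitzan2024, §4 Lemma 10, p. 19 (Step III, "faces at least k different plaquettes") — the ℤ^d model] [cite: GrimmettPercolation1999, §7.2]
-/

noncomputable section

namespace Summit.CriticalPhenomena.PercolationContinuityZ3.Theorems

namespace Transplant

namespace KNLevels

variable {V : Type*} [DecidableEq V]

/-- **Greedy extraction of pairwise far points**: if every `x` has a finite symmetric neighbourhood `nearF x ∋ x` of at most `B ≥ 1`
points, a finite set of at least `K · B` points contains `K` points pairwise outside each other's neighbourhoods (remove a point with
its neighbourhood and recurse). Generalises `exists_subset_card_eq_separated` (`ℤ^d`, sup-balls). [folklore] -/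
theorem exists_subset_card_eq_apart (nearF : V → Finset V) (hself : ∀ x, x ∈ nearF x)
    (hsymm : ∀ x y, y ∈ nearF x → x ∈ nearF y) {B : ℕ} (hB0 : 0 < B) (hB : ∀ x, (nearF x).card ≤ B) :
    ∀ (K : ℕ) (S : Finset V), K * B ≤ S.card →
      ∃ T ⊆ S, T.card = K ∧ ∀ x ∈ T, ∀ y ∈ T, x ≠ y → y ∉ nearF x := by
  intro K
  induction K with
  | zero => intro S _; exact ⟨∅, Finset.empty_subset _, rfl, by simp⟩
  | succ K ih =>
    intro S hS
    have hSne : S.Nonempty := by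
      rw [← Finset.card_pos]
      have : B ≤ (K + 1) * B := Nat.le_mul_of_pos_left _ (Nat.succ_pos K)
      omega
    obtain ⟨x, hx⟩ := hSne
    -- the far part of `S`
    set S' := S.filter fun y => y ∉ nearF x with hS'
    have hnear : (S.filter fun y => y ∈ nearF x).card ≤ B :=
      (Finset.card_le_card fun y hy => (Finset.mem_filter.1 hy).2).trans (hB x)
    have hsplit : (S.filter fun y => y ∈ nearF x).card + S'.card = S.card := by
      rw [hS']
      exact Finset.card_filter_add_card_filter_not _
    have hS'card : K * B ≤ S'.card := by
      have : (K + 1) * B = K * B + B := by ring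
      omega
    obtain ⟨T', hT'S', hT'card, hT'sep⟩ := ih S' hS'card
    have hxT' : x ∉ T' := fun hxT => (Finset.mem_filter.1 (hT'S' hxT)).2 (hself x)
    refine ⟨insert x T', ?_, ?_, ?_⟩
    · intro y hy
      rcases Finset.mem_insert.1 hy with rfl | hy
      · exact hx
      · exact (Finset.mem_filter.1 (hT'S' hy)).1
    · rw [Finset.card_insert_of_notMem hxT', hT'card]
    · intro y hy z hz hyz
      rcases Finset.mem_insert.1 hy with rfl | hy'
      · rcases Finset.mem_insert.1 hz with rfl | hz'
        · exact absurd rfl hyz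
        · exact (Finset.mem_filter.1 (hT'S' hz')).2
      · rcases Finset.mem_insert.1 hz with rfl | hz'
        · exact fun h => (Finset.mem_filter.1 (hT'S' hy')).2 (hsymm _ _ h)
        · exact hT'sep y hy' z hz' hyz


/-- **The packaged selection**: `k` pairwise far vertices of `κ` when `|κ| ≥ k·B`, else `∅` (KN's `selOf`). [cite: KozmaNitzan2024, §4 p. 19 (P_1, …, P_k)] -/
def apartSel (nearF : V → Finset V) (hself : ∀ x, x ∈ nearF x) (hsymm : ∀ x y, y ∈ nearF x → x ∈ nearF y)
    {B : ℕ} (hB0 : 0 < B) (hB : ∀ x, (nearF x).card ≤ B) (k : ℕ) (κ : Finset V) : Finset V :=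
  if h : k * B ≤ κ.card then Classical.choose (exists_subset_card_eq_apart nearF hself hsymm hB0 hB k κ h) else ∅

/-- Specification of `apartSel` on large sets: a `k`-subset, pairwise far. [folklore] -/
theorem apartSel_spec (nearF : V → Finset V) (hself : ∀ x, x ∈ nearF x) (hsymm : ∀ x y, y ∈ nearF x → x ∈ nearF y)
    {B : ℕ} (hB0 : 0 < B) (hB : ∀ x, (nearF x).card ≤ B) {k : ℕ} {κ : Finset V} (h : k * B ≤ κ.card) :
    apartSel nearF hself hsymm hB0 hB k κ ⊆ κ ∧ (apartSel nearF hself hsymm hB0 hB k κ).card = k ∧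
      ∀ x ∈ apartSel nearF hself hsymm hB0 hB k κ, ∀ y ∈ apartSel nearF hself hsymm hB0 hB k κ, x ≠ y → y ∉ nearF x := by
  rw [apartSel, dif_pos h]
  exact Classical.choose_spec (exists_subset_card_eq_apart nearF hself hsymm hB0 hB k κ h)

/-- `apartSel` is always a subset. [folklore] -/
theorem apartSel_subset (nearF : V → Finset V) (hself : ∀ x, x ∈ nearF x) (hsymm : ∀ x y, y ∈ nearF x → x ∈ nearF y)
    {B : ℕ} (hB0 : 0 < B) (hB : ∀ x, (nearF x).card ≤ B) (k : ℕ) (κ : Finset V) :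
    apartSel nearF hself hsymm hB0 hB k κ ⊆ κ := by
  by_cases h : k * B ≤ κ.card
  · exact (apartSel_spec nearF hself hsymm hB0 hB h).1
  · rw [apartSel, dif_neg h]; exact Finset.empty_subset _

/-- **Pairwise-far selected vertices have pairwise disjoint attached sets** whenever far vertices do (the `pick_disj` axiom of
`KNLevels.SHyp` for seeds that are disjoint off the neighbourhoods). [folklore] -/
theorem pairwiseDisjoint_apartSel {ι : Type*} [PartialOrder ι] [OrderBot ι] (nearF : V → Finset V) (hself : ∀ x, x ∈ nearF x)
    (hsymm : ∀ x y, y ∈ nearF x → x ∈ nearF y) {B : ℕ} (hB0 : 0 < B) (hB : ∀ x, (nearF x).card ≤ B) {k : ℕ} {κ : Finset V}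
    (h : k * B ≤ κ.card) {f : V → ι} (hf : ∀ x ∈ κ, ∀ y ∈ κ, y ∉ nearF x → Disjoint (f x) (f y)) :
    (↑(apartSel nearF hself hsymm hB0 hB k κ) : Set V).PairwiseDisjoint f := by
  intro x hx y hy hne
  obtain ⟨hsub, -, hsep⟩ := apartSel_spec nearF hself hsymm hB0 hB h
  exact hf x (hsub (Finset.mem_coe.1 hx)) y (hsub (Finset.mem_coe.1 hy)) (hsep x (Finset.mem_coe.1 hx) y (Finset.mem_coe.1 hy) hne)

end KNLevels

end Transplant

end Summit.CriticalPhenomena.PercolationContinuityZ3.Theorems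

end
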